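/-
Copyright (c) 2026 the pub-hodgecm-mathlib formalisation cell (harness21).  Prover seat hodgecm-mathlib-K2Liu-p09 (g5): Track B «K2-LIT»,
hLiu418 = stmt-HodgeConjecture-24832; LEAD F0P6-plan RULINGS M-156m∕o, M-157a (4) «A7 = GK COCYCLE ROAD», file B4d-1.
-/
import Summits.HodgeConjecture.HodgeConjecture.Theorems.K2LiuDoubledUTwoTwoUnipotentCoordinates   -- ★ B1b-2a (p03): coordinates, frame, letters
import Summits.HodgeConjecture.HodgeConjecture.Theorems.K2LiuDoubledUTwoTwoStepRelations         -- ★ B4c-3 (+ B4c-2, B1a-1∕2∕3)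
import Summits.HodgeConjecture.HodgeConjecture.Theorems.K2LiuDoubledUTwoTwoRankOneRelations      -- ★ B4c-1 `weylTwo_mul_uLongTwo_eq`, `skew_inv`
import Literature.NumberTheory.K2Lit.LocalSiegelIntertwining                                       -- ★ D10 `IsLocalSiegelSection`, `apply_unipDeltaLocal_mul`
import HarnessLib

/-!
# Crux `HLiu418`, road `K2_Liu`, organ A7-reg (GK cocycle road), file B4d-1:
# THE LONG-ROOT STEP IN `H_v`: the `SL₂` relation and the equivariance words of `U(J₄)` transported through `frameConj Q ∘ toLocalFour`

Cell `hodgecm-mathlib`, crux item hLiu418 = `stmt-HodgeConjecture-24832`; squad K2 ∕ K2Liu; prover K2Liu-p09 (g5).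
THEOREMS ONLY (no `def`, no instance, no notation, no named-fact hypothesis, no `sorry`); lane `--supports stmt-HodgeConjecture-24832`
(count-neutral helper).  ONE FRAME (RULING M-156o (c)): every letter below is K2Liu-p03 (g6)'s ★ `U(J₄)(E ⊗ F_v)` letter transported by
`φ := frameConj Q ∘ toLocalFour` (★ B1b-1) into `H_v = U(T₀ ⊕ −T₀)(F_v)` (`localPi E c (2+2) J₂D v`).

THE POINT.  The hypothesis `hrel` of ★ `K2LiuRankOneOperators.integrable_and_integral_eq` for the two `α₂`-steps of the cocycle, and the
equivariance words feeding ★ `integral_mul_unipotent ∕ integral_mul_torus`, for ANY function `F : H_v → ℂ` that is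
  (N) left-invariant under the transported Siegel unipotents `φ(n(x,z,y))` and the Levi unipotents `φ(u_{e₁−e₂}(r))`, and
  (T) a `θ`-eigenfunction of the transported torus: `F(φ(t(a,b)) g) = θ a b · F g`.
A Siegel section `f ∈ I_v(s,χ_v)` is such an `F` (sequel B4d-1b, `θ a b = localSiegelCharacter χ_v s (φ t(a,b))`, once the frame owner's B1b-2c
puts the transported Levi letters in `P_Δ(F_v)`), and so are the partial operators `𝒜F`, `ℬ𝒜F` met along the cocycle.
* §1 **`apply_weylTwo_uLongTwo`** — for a skew unit `x` of `E ⊗ F_v`: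
  `F(φ(w₂) · φ(u_{2e₂}(x)) · g) = θ 1 (−x⁻¹) · F(φ(w₂ u_{2e₂}(x⁻¹) w₂) · g)` (★ B4c-1 `weylTwo_mul_uLongTwo_eq` + (N) + (T)).
* §2 the equivariance words under `φ`: `F(φ(w₂)φ(u(y)) · φ(u₋(r)) · g) = F(φ(w₂)φ(u(y)) · g)` (and `u₊`, `u_{2e₁}`; ★ B4c-3), the shift
  `φ(u(y))φ(u(b)) = φ(u(y+b))`, and the torus word `F(φ(w₂)φ(u(y)) · φ(t(a,b)) · g) = θ a (σb)⁻¹ · F(φ(w₂)φ(u((bσb)⁻¹ y)) · g)`.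
* (sequel B4d-1b `K2LiuSiegelCocycleStepLongSiegel`: Siegel sections satisfy (N) and (T), on K2Liu-p03 (g6)'s B1b-2c Levi transport.)
HONEST LABEL.  `HC_CM` is proved only modulo the 7 printed citations (2 remaining named inputs: hLiu418 = `stmt-HodgeConjecture-24832`,
h413 = `stmt-HodgeConjecture-24833`) until rung 0 closes.

## References
* [Casselman1980] W. Casselman, *The unramified principal series of p-adic groups I*, Compositio Math. 40 (1980), §3.
* [HarrisKudlaSweet1996] M. Harris, S. Kudla, W. J. Sweet, J. AMS 9 (1996), §1 (1.11)–(1.15) (`P_Δ = M_Δ N_Δ`, the inducing character).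
* [KudlaSweet1997] S. Kudla, W. J. Sweet, Israel J. Math. 98 (1997), §1.
-/

set_option autoImplicit false
set_option linter.dupNamespace false -- the mandated namespace repeats `HodgeConjecture.HodgeConjecture`

noncomputable section

open NumberField IsDedekindDomain Matrix
open Literature.NumberTheory.Automorphic Literature.NumberTheory.Automorphic.UnitaryGroup
open Literature.NumberTheory.GelbartRogawski1991.AdaptedBlocks
open Literature.NumberTheory.GelbartRogawski1991.UnitaryDualPair.LocalSplitting
open Literature.NumberTheory.K2Lit.LocalSiegelDoubled
open Summit.HodgeConjecture.HodgeConjecture.Cruxes.HLiu418.K2LiuLocalSiegelIwasawaFrame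
open Summit.HodgeConjecture.HodgeConjecture.Cruxes.HLiu418.K2LiuLocalSiegelIwasawa
open Summit.HodgeConjecture.HodgeConjecture.Cruxes.HLiu418.K2LiuDoubledUTwoTwoBorelFrame
open Summit.HodgeConjecture.HodgeConjecture.Cruxes.HLiu418.K2LiuDoubledUTwoTwoWeylCocycle
open Summit.HodgeConjecture.HodgeConjecture.Cruxes.HLiu418.K2LiuDoubledUTwoTwoLevi
open Summit.HodgeConjecture.HodgeConjecture.Cruxes.HLiu418.K2LiuDoubledUTwoTwoFrameTransport
open Summit.HodgeConjecture.HodgeConjecture.Cruxes.HLiu418.K2LiuDoubledUTwoTwoRankOneRelations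
open Summit.HodgeConjecture.HodgeConjecture.Cruxes.HLiu418.K2LiuDoubledUTwoTwoRankOneRelationsLevi
open Summit.HodgeConjecture.HodgeConjecture.Cruxes.HLiu418.K2LiuDoubledUTwoTwoStepRelations

namespace Summit.HodgeConjecture.HodgeConjecture.Cruxes.HLiu418.K2LiuSiegelCocycleStepLong

variable (F : Type) [Field F] [NumberField F] (E : Type) [Field E] [NumberField E] [Algebra F E]
  [Algebra.IsQuadraticExtension F E] (c : E ≃ₐ[F] E)
  {δ : E} (hcδ : c δ = -δ) (hδ : δ ≠ 0) (v : HeightOneSpectrum (𝓞 F))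
  {T₂ : Matrix (Fin 2) (Fin 2) F} {J₂D : Matrix (Fin (2 + 2)) (Fin (2 + 2)) E} (hJ₂D : J₂D = (gramD F 2 T₂).map (algebraMap F E))
  (Q : GL (Fin (2 + 2)) F)
  (hQ : (Q : Matrix (Fin (2 + 2)) (Fin (2 + 2)) F)ᵀ * gramD F 2 T₂ * (Q : Matrix (Fin (2 + 2)) (Fin (2 + 2)) F) = (StdForm.antidiagonal (2 + 2)).over F)

/-! ## §1 The long-root `SL₂` relation in `H_v` for a function with (N) and (T) -/

/-- **THE LONG-ROOT RELATION IN `H_v`.**  Let `F : H_v → ℂ` be left-invariant under the transported root letter `φ(u_{2e₂}(r))` (all skew `r`)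
and a `θ`-eigenfunction of the transported torus.  Then for every skew UNIT `x` of `E ⊗ F_v` and every `g`,
`F(φ(w₂) · φ(u_{2e₂}(x)) · g) = θ 1 (−x⁻¹) · F(φ(w₂ · u_{2e₂}(x⁻¹) · w₂) · g)` — ★ B4c-1 `weylTwo_mul_uLongTwo_eq` pushed through the
homomorphism `φ = frameConj Q ∘ toLocalFour`. [cite: Casselman1980, §3] [cite: HarrisKudlaSweet1996, §1 (1.15)] -/
theorem apply_weylTwo_uLongTwo (F' : UnitaryGroup.localPi E c (2 + 2) J₂D v → ℂ)
    (θ : (UnitaryGroup.LocalRing E v)ˣ → (UnitaryGroup.LocalRing E v)ˣ → ℂ)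
    (hU : ∀ (r : UnitaryGroup.LocalRing E v) (hr : UnitaryGroup.conjLocal E c v r = -r) (g : UnitaryGroup.localPi E c (2 + 2) J₂D v),
      F' (FrameTransport.frameConj F E c v (2 + 2) hJ₂D (antidiagonal_over_eq_map F E 2) Q hQ
        (toLocalFour F E c v (uLongTwo (UnitaryGroup.LocalRing E v) (UnitaryGroup.conjLocal E c v) r hr)) * g) = F' g)
    (hT : ∀ (a b : (UnitaryGroup.LocalRing E v)ˣ) (g : UnitaryGroup.localPi E c (2 + 2) J₂D v),
      F' (FrameTransport.frameConj F E c v (2 + 2) hJ₂D (antidiagonal_over_eq_map F E 2) Q hQ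
        (toLocalFour F E c v (torusElt (UnitaryGroup.LocalRing E v) (UnitaryGroup.conjLocal E c v)
          (UnitaryGroup.conjLocal_conjLocal c v hcδ hδ) a b)) * g) = θ a b * F' g)
    (x : (UnitaryGroup.LocalRing E v)ˣ) (hx : UnitaryGroup.conjLocal E c v (x : UnitaryGroup.LocalRing E v) = -(x : UnitaryGroup.LocalRing E v))
    (g : UnitaryGroup.localPi E c (2 + 2) J₂D v) :
    F' (FrameTransport.frameConj F E c v (2 + 2) hJ₂D (antidiagonal_over_eq_map F E 2) Q hQ
          (toLocalFour F E c v (weylTwo (UnitaryGroup.LocalRing E v) (UnitaryGroup.conjLocal E c v))) *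
        FrameTransport.frameConj F E c v (2 + 2) hJ₂D (antidiagonal_over_eq_map F E 2) Q hQ
          (toLocalFour F E c v (uLongTwo (UnitaryGroup.LocalRing E v) (UnitaryGroup.conjLocal E c v) (x : UnitaryGroup.LocalRing E v) hx)) * g) =
      θ 1 (-x⁻¹) *
        F' (FrameTransport.frameConj F E c v (2 + 2) hJ₂D (antidiagonal_over_eq_map F E 2) Q hQ
          (toLocalFour F E c v (weylTwo (UnitaryGroup.LocalRing E v) (UnitaryGroup.conjLocal E c v) *
            uLongTwo (UnitaryGroup.LocalRing E v) (UnitaryGroup.conjLocal E c v) ((x⁻¹ : (UnitaryGroup.LocalRing E v)ˣ) : _) (skew_inv hx) *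
            weylTwo (UnitaryGroup.LocalRing E v) (UnitaryGroup.conjLocal E c v))) * g) := by
  -- the `SL₂` relation of ★ B4c-1, transported and multiplied by `g` on the right
  have hrel := congrArg (fun g' => FrameTransport.frameConj F E c v (2 + 2) hJ₂D (antidiagonal_over_eq_map F E 2) Q hQ (toLocalFour F E c v g') * g)
    (weylTwo_mul_uLongTwo_eq (UnitaryGroup.LocalRing E v) (UnitaryGroup.conjLocal E c v) (UnitaryGroup.conjLocal_conjLocal c v hcδ hδ) x hx)
  simp only [map_mul, mul_assoc] at hrel ⊢
  rw [hrel, hU, hT]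

/-! ## §2 The equivariance words in `H_v` -/

/-- **the `u_{e₁−e₂}`-word**: for `F` invariant under the transported `P_Δ`-unipotents `φ(u₊)`, `φ(u_{2e₁})`, `φ(u₋)`,
`F(φ(w₂)φ(u(y)) · φ(u₋(r)) · g) = F(φ(w₂)φ(u(y)) · g)` (★ B4c-3 `weylTwo_uLongTwo_mul_uMinus`). [cite: Casselman1980, §3] -/
theorem apply_weylTwo_uLongTwo_mul_uMinus (F' : UnitaryGroup.localPi E c (2 + 2) J₂D v → ℂ)
    (hP : ∀ (z : UnitaryGroup.LocalRing E v) (g : UnitaryGroup.localPi E c (2 + 2) J₂D v),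
      F' (FrameTransport.frameConj F E c v (2 + 2) hJ₂D (antidiagonal_over_eq_map F E 2) Q hQ
        (toLocalFour F E c v (uPlus (UnitaryGroup.LocalRing E v) (UnitaryGroup.conjLocal E c v) (UnitaryGroup.conjLocal_conjLocal c v hcδ hδ) z)) * g) = F' g)
    (hL : ∀ (y : UnitaryGroup.LocalRing E v) (hy : UnitaryGroup.conjLocal E c v y = -y) (g : UnitaryGroup.localPi E c (2 + 2) J₂D v),
      F' (FrameTransport.frameConj F E c v (2 + 2) hJ₂D (antidiagonal_over_eq_map F E 2) Q hQ
        (toLocalFour F E c v (uLongOne (UnitaryGroup.LocalRing E v) (UnitaryGroup.conjLocal E c v) y hy)) * g) = F' g)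
    (hM : ∀ (z : UnitaryGroup.LocalRing E v) (g : UnitaryGroup.localPi E c (2 + 2) J₂D v),
      F' (FrameTransport.frameConj F E c v (2 + 2) hJ₂D (antidiagonal_over_eq_map F E 2) Q hQ
        (toLocalFour F E c v (uMinus (UnitaryGroup.LocalRing E v) (UnitaryGroup.conjLocal E c v) (UnitaryGroup.conjLocal_conjLocal c v hcδ hδ) z)) * g) = F' g)
    (y r : UnitaryGroup.LocalRing E v) (hy : UnitaryGroup.conjLocal E c v y = -y) (g : UnitaryGroup.localPi E c (2 + 2) J₂D v) :
    F' (FrameTransport.frameConj F E c v (2 + 2) hJ₂D (antidiagonal_over_eq_map F E 2) Q hQ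
          (toLocalFour F E c v (weylTwo (UnitaryGroup.LocalRing E v) (UnitaryGroup.conjLocal E c v))) *
        FrameTransport.frameConj F E c v (2 + 2) hJ₂D (antidiagonal_over_eq_map F E 2) Q hQ
          (toLocalFour F E c v (uLongTwo (UnitaryGroup.LocalRing E v) (UnitaryGroup.conjLocal E c v) y hy)) *
        (FrameTransport.frameConj F E c v (2 + 2) hJ₂D (antidiagonal_over_eq_map F E 2) Q hQ
          (toLocalFour F E c v (uMinus (UnitaryGroup.LocalRing E v) (UnitaryGroup.conjLocal E c v) (UnitaryGroup.conjLocal_conjLocal c v hcδ hδ) r)) * g)) =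
      F' (FrameTransport.frameConj F E c v (2 + 2) hJ₂D (antidiagonal_over_eq_map F E 2) Q hQ
          (toLocalFour F E c v (weylTwo (UnitaryGroup.LocalRing E v) (UnitaryGroup.conjLocal E c v))) *
        FrameTransport.frameConj F E c v (2 + 2) hJ₂D (antidiagonal_over_eq_map F E 2) Q hQ
          (toLocalFour F E c v (uLongTwo (UnitaryGroup.LocalRing E v) (UnitaryGroup.conjLocal E c v) y hy)) * g) := by
  have hword := congrArg (fun g' => FrameTransport.frameConj F E c v (2 + 2) hJ₂D (antidiagonal_over_eq_map F E 2) Q hQ (toLocalFour F E c v g') * g)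
    (weylTwo_uLongTwo_mul_uMinus (R := UnitaryGroup.LocalRing E v) (σ := UnitaryGroup.conjLocal E c v)
      (UnitaryGroup.conjLocal_conjLocal c v hcδ hδ) y r hy)
  simp only [map_mul, mul_assoc] at hword ⊢
  rw [hword, hP, hL, hM]

/-- **the `u_{e₁+e₂}`-word**: for `F` invariant under the Levi unipotents `φ(u₋)`: `F(φ(w₂)φ(u(y)) · φ(u₊(b)) · g) = F(φ(w₂)φ(u(y)) · g)`
(★ B4c-3 `weylTwo_uLongTwo_mul_uPlus`). [cite: Casselman1980, §3] -/
theorem apply_weylTwo_uLongTwo_mul_uPlus (F' : UnitaryGroup.localPi E c (2 + 2) J₂D v → ℂ)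
    (hM : ∀ (z : UnitaryGroup.LocalRing E v) (g : UnitaryGroup.localPi E c (2 + 2) J₂D v),
      F' (FrameTransport.frameConj F E c v (2 + 2) hJ₂D (antidiagonal_over_eq_map F E 2) Q hQ
        (toLocalFour F E c v (uMinus (UnitaryGroup.LocalRing E v) (UnitaryGroup.conjLocal E c v) (UnitaryGroup.conjLocal_conjLocal c v hcδ hδ) z)) * g) = F' g)
    (y b : UnitaryGroup.LocalRing E v) (hy : UnitaryGroup.conjLocal E c v y = -y) (g : UnitaryGroup.localPi E c (2 + 2) J₂D v) :
    F' (FrameTransport.frameConj F E c v (2 + 2) hJ₂D (antidiagonal_over_eq_map F E 2) Q hQ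
          (toLocalFour F E c v (weylTwo (UnitaryGroup.LocalRing E v) (UnitaryGroup.conjLocal E c v))) *
        FrameTransport.frameConj F E c v (2 + 2) hJ₂D (antidiagonal_over_eq_map F E 2) Q hQ
          (toLocalFour F E c v (uLongTwo (UnitaryGroup.LocalRing E v) (UnitaryGroup.conjLocal E c v) y hy)) *
        (FrameTransport.frameConj F E c v (2 + 2) hJ₂D (antidiagonal_over_eq_map F E 2) Q hQ
          (toLocalFour F E c v (uPlus (UnitaryGroup.LocalRing E v) (UnitaryGroup.conjLocal E c v) (UnitaryGroup.conjLocal_conjLocal c v hcδ hδ) b)) * g)) =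
      F' (FrameTransport.frameConj F E c v (2 + 2) hJ₂D (antidiagonal_over_eq_map F E 2) Q hQ
          (toLocalFour F E c v (weylTwo (UnitaryGroup.LocalRing E v) (UnitaryGroup.conjLocal E c v))) *
        FrameTransport.frameConj F E c v (2 + 2) hJ₂D (antidiagonal_over_eq_map F E 2) Q hQ
          (toLocalFour F E c v (uLongTwo (UnitaryGroup.LocalRing E v) (UnitaryGroup.conjLocal E c v) y hy)) * g) := by
  have hword := congrArg (fun g' => FrameTransport.frameConj F E c v (2 + 2) hJ₂D (antidiagonal_over_eq_map F E 2) Q hQ (toLocalFour F E c v g') * g)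
    (weylTwo_uLongTwo_mul_uPlus (R := UnitaryGroup.LocalRing E v) (σ := UnitaryGroup.conjLocal E c v) (UnitaryGroup.conjLocal_conjLocal c v hcδ hδ) y b hy)
  simp only [map_mul, mul_assoc] at hword ⊢
  rw [hword, hM]

omit [Algebra.IsQuadraticExtension F E] in
/-- **the `u_{2e₁}`-word**: for `F` invariant under `φ(u_{2e₁})`: `F(φ(w₂)φ(u(y)) · φ(u_{2e₁}(b)) · g) = F(φ(w₂)φ(u(y)) · g)`
(★ B4c-3 `weylTwo_uLongTwo_mul_uLongOne`). [cite: Casselman1980, §3] -/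
theorem apply_weylTwo_uLongTwo_mul_uLongOne (F' : UnitaryGroup.localPi E c (2 + 2) J₂D v → ℂ)
    (hL : ∀ (y : UnitaryGroup.LocalRing E v) (hy : UnitaryGroup.conjLocal E c v y = -y) (g : UnitaryGroup.localPi E c (2 + 2) J₂D v),
      F' (FrameTransport.frameConj F E c v (2 + 2) hJ₂D (antidiagonal_over_eq_map F E 2) Q hQ
        (toLocalFour F E c v (uLongOne (UnitaryGroup.LocalRing E v) (UnitaryGroup.conjLocal E c v) y hy)) * g) = F' g)
    (y b : UnitaryGroup.LocalRing E v) (hy : UnitaryGroup.conjLocal E c v y = -y) (hb : UnitaryGroup.conjLocal E c v b = -b) (g : UnitaryGroup.localPi E c (2 + 2) J₂D v) :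
    F' (FrameTransport.frameConj F E c v (2 + 2) hJ₂D (antidiagonal_over_eq_map F E 2) Q hQ
          (toLocalFour F E c v (weylTwo (UnitaryGroup.LocalRing E v) (UnitaryGroup.conjLocal E c v))) *
        FrameTransport.frameConj F E c v (2 + 2) hJ₂D (antidiagonal_over_eq_map F E 2) Q hQ
          (toLocalFour F E c v (uLongTwo (UnitaryGroup.LocalRing E v) (UnitaryGroup.conjLocal E c v) y hy)) *
        (FrameTransport.frameConj F E c v (2 + 2) hJ₂D (antidiagonal_over_eq_map F E 2) Q hQ
          (toLocalFour F E c v (uLongOne (UnitaryGroup.LocalRing E v) (UnitaryGroup.conjLocal E c v) b hb)) * g)) =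
      F' (FrameTransport.frameConj F E c v (2 + 2) hJ₂D (antidiagonal_over_eq_map F E 2) Q hQ
          (toLocalFour F E c v (weylTwo (UnitaryGroup.LocalRing E v) (UnitaryGroup.conjLocal E c v))) *
        FrameTransport.frameConj F E c v (2 + 2) hJ₂D (antidiagonal_over_eq_map F E 2) Q hQ
          (toLocalFour F E c v (uLongTwo (UnitaryGroup.LocalRing E v) (UnitaryGroup.conjLocal E c v) y hy)) * g) := by
  have hword := congrArg (fun g' => FrameTransport.frameConj F E c v (2 + 2) hJ₂D (antidiagonal_over_eq_map F E 2) Q hQ (toLocalFour F E c v g') * g)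
    (weylTwo_uLongTwo_mul_uLongOne (R := UnitaryGroup.LocalRing E v) (σ := UnitaryGroup.conjLocal E c v) y b hy hb)
  simp only [map_mul, mul_assoc] at hword ⊢
  rw [hword, hL]

omit [Algebra.IsQuadraticExtension F E] in
/-- **the shift word**: `φ(w₂)φ(u(y)) · φ(u(b)) · g = φ(w₂)φ(u(y + b)) · g` (★ `uLongTwo_mul` through `φ`). [cite: Casselman1980, §3] -/
theorem weylTwo_uLongTwo_mul_uLongTwo_apply (y b : UnitaryGroup.LocalRing E v) (hy : UnitaryGroup.conjLocal E c v y = -y)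
    (hb : UnitaryGroup.conjLocal E c v b = -b) (g : UnitaryGroup.localPi E c (2 + 2) J₂D v) :
    FrameTransport.frameConj F E c v (2 + 2) hJ₂D (antidiagonal_over_eq_map F E 2) Q hQ
          (toLocalFour F E c v (weylTwo (UnitaryGroup.LocalRing E v) (UnitaryGroup.conjLocal E c v))) *
        FrameTransport.frameConj F E c v (2 + 2) hJ₂D (antidiagonal_over_eq_map F E 2) Q hQ
          (toLocalFour F E c v (uLongTwo (UnitaryGroup.LocalRing E v) (UnitaryGroup.conjLocal E c v) y hy)) *
        (FrameTransport.frameConj F E c v (2 + 2) hJ₂D (antidiagonal_over_eq_map F E 2) Q hQ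
          (toLocalFour F E c v (uLongTwo (UnitaryGroup.LocalRing E v) (UnitaryGroup.conjLocal E c v) b hb)) * g) =
      FrameTransport.frameConj F E c v (2 + 2) hJ₂D (antidiagonal_over_eq_map F E 2) Q hQ
          (toLocalFour F E c v (weylTwo (UnitaryGroup.LocalRing E v) (UnitaryGroup.conjLocal E c v))) *
        FrameTransport.frameConj F E c v (2 + 2) hJ₂D (antidiagonal_over_eq_map F E 2) Q hQ
          (toLocalFour F E c v (uLongTwo (UnitaryGroup.LocalRing E v) (UnitaryGroup.conjLocal E c v) (y + b) (by rw [map_add, hy, hb, neg_add]))) * g := by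
  have hword := congrArg (fun g' => FrameTransport.frameConj F E c v (2 + 2) hJ₂D (antidiagonal_over_eq_map F E 2) Q hQ (toLocalFour F E c v g') * g)
    (weylTwo_mul_uLongTwo_mul_uLongTwo (UnitaryGroup.LocalRing E v) (UnitaryGroup.conjLocal E c v) y b hy hb)
  simp only [map_mul, mul_assoc] at hword ⊢
  rw [hword]

/-- **the torus word**: for a `θ`-eigenfunction `F` of the transported torus,
`F(φ(w₂)φ(u(y)) · φ(t(a,b)) · g) = θ a (σ(b)⁻¹) · F(φ(w₂)φ(u((bσb)⁻¹ y)) · g)` (★ B4c-3 `weylTwo_uLongTwo_mul_torusElt`): the root variable is rescaled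
by the `σ`-invariant unit `(bσb)⁻¹`. [cite: Casselman1980, §3] -/
theorem apply_weylTwo_uLongTwo_mul_torusElt (F' : UnitaryGroup.localPi E c (2 + 2) J₂D v → ℂ)
    (θ : (UnitaryGroup.LocalRing E v)ˣ → (UnitaryGroup.LocalRing E v)ˣ → ℂ)
    (hT : ∀ (a b : (UnitaryGroup.LocalRing E v)ˣ) (g : UnitaryGroup.localPi E c (2 + 2) J₂D v),
      F' (FrameTransport.frameConj F E c v (2 + 2) hJ₂D (antidiagonal_over_eq_map F E 2) Q hQ
        (toLocalFour F E c v (torusElt (UnitaryGroup.LocalRing E v) (UnitaryGroup.conjLocal E c v)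
          (UnitaryGroup.conjLocal_conjLocal c v hcδ hδ) a b)) * g) = θ a b * F' g)
    (y : UnitaryGroup.LocalRing E v) (hy : UnitaryGroup.conjLocal E c v y = -y) (a b : (UnitaryGroup.LocalRing E v)ˣ) (g : UnitaryGroup.localPi E c (2 + 2) J₂D v) :
    F' (FrameTransport.frameConj F E c v (2 + 2) hJ₂D (antidiagonal_over_eq_map F E 2) Q hQ
          (toLocalFour F E c v (weylTwo (UnitaryGroup.LocalRing E v) (UnitaryGroup.conjLocal E c v))) *
        FrameTransport.frameConj F E c v (2 + 2) hJ₂D (antidiagonal_over_eq_map F E 2) Q hQ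
          (toLocalFour F E c v (uLongTwo (UnitaryGroup.LocalRing E v) (UnitaryGroup.conjLocal E c v) y hy)) *
        (FrameTransport.frameConj F E c v (2 + 2) hJ₂D (antidiagonal_over_eq_map F E 2) Q hQ
          (toLocalFour F E c v (torusElt (UnitaryGroup.LocalRing E v) (UnitaryGroup.conjLocal E c v)
            (UnitaryGroup.conjLocal_conjLocal c v hcδ hδ) a b)) * g)) =
      θ a (Units.map (UnitaryGroup.conjLocal E c v : UnitaryGroup.LocalRing E v →* UnitaryGroup.LocalRing E v) b⁻¹) *
        F' (FrameTransport.frameConj F E c v (2 + 2) hJ₂D (antidiagonal_over_eq_map F E 2) Q hQ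
          (toLocalFour F E c v (weylTwo (UnitaryGroup.LocalRing E v) (UnitaryGroup.conjLocal E c v))) *
          FrameTransport.frameConj F E c v (2 + 2) hJ₂D (antidiagonal_over_eq_map F E 2) Q hQ
          (toLocalFour F E c v (uLongTwo (UnitaryGroup.LocalRing E v) (UnitaryGroup.conjLocal E c v) ((((b * Units.map (UnitaryGroup.conjLocal E c v : UnitaryGroup.LocalRing E v →* UnitaryGroup.LocalRing E v) b)⁻¹ : (UnitaryGroup.LocalRing E v)ˣ) : UnitaryGroup.LocalRing E v) * y) (skew_norm_inv_mul (UnitaryGroup.conjLocal_conjLocal c v hcδ hδ) b hy))) * g) := by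
  have hword := congrArg (fun g' => FrameTransport.frameConj F E c v (2 + 2) hJ₂D (antidiagonal_over_eq_map F E 2) Q hQ (toLocalFour F E c v g') * g)
    (weylTwo_uLongTwo_mul_torusElt (R := UnitaryGroup.LocalRing E v) (σ := UnitaryGroup.conjLocal E c v) (UnitaryGroup.conjLocal_conjLocal c v hcδ hδ) y hy a b)
  simp only [map_mul, mul_assoc] at hword ⊢
  rw [hword, hT]

end Summit.HodgeConjecture.HodgeConjecture.Cruxes.HLiu418.K2LiuSiegelCocycleStepLong

end
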